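import Mathlib
import HarnessLib
import Summits.NavierStokesRegularity.NavierStokesRegularity.Theorems.PoloidalWindowDoorLrcModEntireJetCertPsatzSubst

/-!
# Jet-certificate checker — ELIMINATION TRANSCRIPTS at point level: pivot (`elim`), forced vanishing (`force`), split, chunk, leaf;
# «every solution of the generated identity system has its twist unknowns = 0» (`Kills`) by ONE Boolean

Cell pub-ns-dss, seat ns-crc-p1 gen 5 (Lean-certificate hand of the wall experiment `ns-wall-extremal`, arm C; PREREG-WALL-1 §C, ARM-C-PLAN §C.3),
2026-08-28. `--supports stmt-NavierStokesRegularity-19708` (wall W4 `PoloidalWindowRigidity`, instrument).  Generic real algebra; no Navier–Stokes content.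

WHAT IT REPLAYS.  Arm C's engine (eng-2; K2-p5's `tjet_gen`/`tilt3d_symbolic`/`robust_solve2` of record) decides a polynomial-sector cell — a finite system of
polynomial identities in finitely many unknown coefficients — by a GREEDY EXACT ELIMINATION: pick an identity that is LINEAR in some unknown `X_i` with a
coefficient `c` that cannot vanish (a non-zero rational, or `κ·γ^a(1+γ²)^b` with `γ ≠ 0` pinned), substitute `X_i := −R/c` everywhere (denominators cleared),
repeat; an identity that collapses to `κ·c·X_j^e` FORCES `X_j = 0`; when every y- or z-carrying («twist») unknown has been forced to `0` the cell is UNTWISTED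
(KILL).  The transcript «step k: identity index, unknown, pivot» is the certificate.  This file replays it WITHOUT COFACTORS: at a real point where the
identities hold, `X_i` really equals `−R/c`, so substituting it into every law / pin / sign polynomial preserves the point (`ev_substQ`); nothing about ideal
membership is needed, and the kernel's work equals the engine's.

* the one-letter substitution and its soundness live in `…JetCertPsatzSubst` (`substLaw`, `substSign`, `ev_linear_split`, `ev_substQ`, rescaling);
* `ETree` = `leaf` (Positivstellensatz leaf of `…JetCertPsatz`) | `chunk` | `split` | `elim k i κ pe t` | `force k j κ pe e t`; the Boolean `etreeCheck` and
  **`not_pointDatum_of_etreeCheck`**;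
* `Kills n hyps pins zs nonneg J` («every real solution with the pins non-zero … has `X_j = 0` for all `j ∈ J`»), `sumSq`, the Boolean `killCheck` and
  **`kills_of_killCheck`** — the by-name shape of an arm-C row theorem `<cell>_kill`;
* self-test (`decide +kernel`): a 3-letter toy transcript.

WHAT THIS IS NOT: not a claim about Navier–Stokes, not a certificate, and not the reduction «generated identity system = coefficient system of Theorem Q's
identities for the cell» (POLY-SECTOR-K2p5.md §12, on paper; each landed row says so in its docstring). [folklore]
-/

noncomputable section

-- the summit and its single sub-problem share the name (CONVENTIONS §1), as in every Theorems file
set_option linter.dupNamespace false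

namespace Summit.NavierStokesRegularity.NavierStokesRegularity.Theorems.PoloidalWindowDoorLrcModEntireJetCertPsatzElim

open _root_.Topology _root_.Filter Set
open Literature.Analysis.ValidatedNumerics Literature.Analysis.ValidatedNumerics.QMvPoly
open Literature.Analysis.Calculus.MvPoly
open Summit.NavierStokesRegularity.NavierStokesRegularity.Theorems.PoloidalWindowDoorLrcModEntireJetCertDefs
open Summit.NavierStokesRegularity.NavierStokesRegularity.Theorems.PoloidalWindowDoorLrcModEntireJetCertTree
open Summit.NavierStokesRegularity.NavierStokesRegularity.Theorems.PoloidalWindowDoorLrcModEntireJetCertFast2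
open Summit.NavierStokesRegularity.NavierStokesRegularity.Theorems.PoloidalWindowDoorLrcModEntireJetCertGauge
open Summit.NavierStokesRegularity.NavierStokesRegularity.Theorems.PoloidalWindowDoorLrcModEntireJetCertPsatz
open Summit.NavierStokesRegularity.NavierStokesRegularity.Theorems.PoloidalWindowDoorLrcModEntireJetCertPsatzSubst

variable {n : ℕ}

/-! ### Transcript trees -/

/-- **AN ELIMINATION TRANSCRIPT TREE.**  `leaf c`: close by the Positivstellensatz leaf `c`; `chunk comb T t`: adjoin `T ≡ Σ cᵢ law_{kᵢ}`; `split π nz z`: branch on `π`;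
`elim k i κ pe t`: law `k` is `c·X_i + R` with `c ≡ κ·pins^pe` (`κ ≠ 0`), substitute `X_i := −R/c` in every law, pin and sign constraint, continue with `t`;
`force k j κ pe e t`: law `k` is syntactically `κ·pins^pe·X_j^e` with `κ ≠ 0`, `e ≥ 1`, so `X_j = 0` joins the laws; continue with `t`. [folklore] -/
inductive ETree : Type
  | leaf : PsatzLeaf → ETree
  | chunk : List (QMvPoly × ℕ) → QMvPoly → ETree → ETree
  | split : QMvPoly → ETree → ETree → ETree
  | elim : ℕ → ℕ → ℚ → List ℕ → ETree → ETree
  | force : ℕ → ℕ → ℚ → List ℕ → ℕ → ETree → ETree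

/-- Syntactic equality of two term lists as polynomials (normalised difference is empty). [folklore] -/
def polyEq (p q : QMvPoly) : Bool :=
  decide (normalizeS (trimQ (p ++ QMvPoly.smul (-1) q)) = [])

/-- `polyEq` is sound. [folklore] -/
theorem ev_eq_of_polyEq {p q : QMvPoly} (h : polyEq p q = true) (z : EuclideanSpace ℝ (Fin n)) : ev n p z = ev n q z := by
  simp only [polyEq, decide_eq_true_eq] at h
  have h0 : ev n (normalizeS (trimQ (p ++ QMvPoly.smul (-1) q))) z = 0 := by rw [h, ev_nil]
  rw [ev_normalizeS, ev_trimQ, ev_append, ev_smul] at h0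
  have : ev n p z + (-1 : ℝ) * ev n q z = 0 := by simpa using h0
  linarith

/-- **THE TRANSCRIPT CHECK** (Boolean, structural recursion on the tree). [folklore] -/
def etreeCheck (n : ℕ) : List QMvPoly → List QMvPoly → List ℕ → List QMvPoly → ETree → Bool
  | hyps, pins, zs, nonneg, .leaf c => pointCheckP n hyps pins zs nonneg c
  | hyps, pins, zs, nonneg, .chunk comb T t =>
      polyEq T (idealComb hyps comb) && etreeCheck n (hyps ++ [T]) pins zs nonneg t
  | hyps, pins, zs, nonneg, .split π nz z => etreeCheck n hyps (pins ++ [π]) zs nonneg nz && etreeCheck n (hyps ++ [π]) pins zs nonneg z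
  | hyps, pins, zs, nonneg, .elim k i κ pe t =>
      let L := hyps.getD k []
      let c := coeffIn i L
      let num := QMvPoly.smul (-1) (restIn i L)
      decide (i < n) && decide (κ ≠ 0) && decide (degIn i L ≤ 1) && polyEq c (QMvPoly.smul κ (pinProduct pins pe)) &&
        etreeCheck n (hyps.map (substLaw i num c)) (pins.map (substLaw i num c)) zs (nonneg.map (substSign i num c)) t
  | hyps, pins, zs, nonneg, .force k j κ pe e t =>
      decide (j < n) && decide (κ ≠ 0) && decide (1 ≤ e) &&
        polyEq (hyps.getD k []) (QMvPoly.smul κ (QMvPoly.mul (pinProduct pins pe) (powQ (QMvPoly.var n j) e))) &&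
        etreeCheck n (hyps ++ [QMvPoly.var n j]) pins zs nonneg t

/-- `ev` of the variable `X_j`. [folklore] -/
theorem ev_var (z : EuclideanSpace ℝ (Fin n)) (j : Fin n) : ev n (QMvPoly.var n j) z = z j := by
  rw [ev, QMvPoly.toMv_var, toFun_apply]; simp

/-- A law read by index vanishes at a point datum's point. [folklore] -/
theorem ev_getD_eq_zero {hyps : List QMvPoly} {z : EuclideanSpace ℝ (Fin n)} (hh : ∀ L ∈ hyps, ev n L z = 0) (k : ℕ) :
    ev n (hyps.getD k []) z = 0 := by
  rw [List.getD_eq_getElem?_getD]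
  cases h : hyps[k]? with
  | none => simp
  | some L => simpa using hh L (List.mem_of_getElem? h)

/-- **SOUNDNESS OF TRANSCRIPT TREES**: a checked tree proves that the semi-algebraic set `{hyps = 0, pins ≠ 0, gauge = 0, nonneg ≥ 0}` has no real point. [folklore] -/
theorem not_pointDatum_of_etreeCheck : ∀ (t : ETree) {hyps pins : List QMvPoly} {zs : List ℕ} {nonneg : List QMvPoly},
    etreeCheck n hyps pins zs nonneg t = true → ¬ PointDatum n hyps pins zs nonneg := by
  intro t
  induction t with
  | leaf c => intro hyps pins zs nonneg h; exact not_pointDatum_of_pointCheckP h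
  | chunk comb T t ih =>
    intro hyps pins zs nonneg h hd
    simp only [etreeCheck, Bool.and_eq_true] at h
    obtain ⟨z, hh, hp, hz, hq⟩ := hd
    refine ih h.2 ⟨z, ?_, hp, hz, hq⟩
    intro L hL
    rcases List.mem_append.1 hL with hL' | hL'
    · exact hh L hL'
    · rw [List.mem_singleton.1 hL', ev_eq_of_polyEq h.1 z, ev_idealComb_eq_zero z hyps hh]
  | split π nz zt ihnz ihz =>
    intro hyps pins zs nonneg h hd
    simp only [etreeCheck, Bool.and_eq_true] at h
    obtain ⟨z, hh, hp, hz, hq⟩ := hd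
    by_cases hπ : ev n π z = 0
    · refine ihz h.2 ⟨z, ?_, hp, hz, hq⟩
      intro L hL
      rcases List.mem_append.1 hL with hL' | hL'
      · exact hh L hL'
      · rw [List.mem_singleton.1 hL']; exact hπ
    · refine ihnz h.1 ⟨z, hh, ?_, hz, hq⟩
      intro π' hπ'
      rcases List.mem_append.1 hπ' with h' | h'
      · exact hp π' h'
      · rw [List.mem_singleton.1 h']; exact hπ
  | elim k i κ pe t ih =>
    intro hyps pins zs nonneg h hd
    simp only [etreeCheck, Bool.and_eq_true, decide_eq_true_eq] at h
    obtain ⟨⟨⟨⟨hi, hκ⟩, hdeg⟩, hc⟩, ht⟩ := h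
    obtain ⟨z, hh, hp, hz, hq⟩ := hd
    set L := hyps.getD k [] with hL
    set c := coeffIn i L with hc_def
    set num := QMvPoly.smul (-1) (restIn i L) with hnum
    -- the pivot coefficient does not vanish at z, and c(z)·z_i = num(z)
    have hcz : ev n c z ≠ 0 := by
      rw [ev_eq_of_polyEq hc z, ev_smul]
      exact mul_ne_zero (by exact_mod_cast hκ) (ev_pinProduct_ne_zero z pins pe hp)
    have hLz : ev n L z = 0 := ev_getD_eq_zero hh k
    have hlin := ev_linear_split z ⟨i, hi⟩ L hdeg
    have hzi : ev n c z * z ⟨i, hi⟩ = ev n num z := by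
      rw [hnum, ev_smul]; push_cast
      have : z ⟨i, hi⟩ * ev n c z + ev n (restIn i L) z = 0 := by rw [← hLz, hlin]
      linarith
    refine ih ht ⟨z, ?_, ?_, hz, ?_⟩
    · intro L' hL'
      obtain ⟨P, hP, rfl⟩ := List.mem_map.1 hL'
      exact ev_substLaw_eq_zero z ⟨i, hi⟩ num c hzi (hh P hP)
    · intro π' hπ'
      obtain ⟨P, hP, rfl⟩ := List.mem_map.1 hπ'
      exact ev_substLaw_ne_zero z ⟨i, hi⟩ num c hzi hcz (hp P hP)
    · intro q' hq'
      obtain ⟨P, hP, rfl⟩ := List.mem_map.1 hq'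
      exact ev_substSign_nonneg z ⟨i, hi⟩ num c hzi (hq P hP)
  | force k j κ pe e t ih =>
    intro hyps pins zs nonneg h hd
    simp only [etreeCheck, Bool.and_eq_true, decide_eq_true_eq] at h
    obtain ⟨⟨⟨⟨hj, hκ⟩, he⟩, hform⟩, ht⟩ := h
    obtain ⟨z, hh, hp, hz, hq⟩ := hd
    have hLz : ev n (hyps.getD k []) z = 0 := ev_getD_eq_zero hh k
    rw [ev_eq_of_polyEq hform z, ev_smul, ev_mul, ev_powQ, ev_var z ⟨j, hj⟩] at hLz
    have hzj : z ⟨j, hj⟩ = 0 := by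
      have h1 : (κ : ℝ) ≠ 0 := by exact_mod_cast hκ
      have h2 := ev_pinProduct_ne_zero z pins pe hp
      have h3 : z ⟨j, hj⟩ ^ e = 0 := by
        rcases mul_eq_zero.1 hLz with h | h
        · exact absurd h h1
        · rcases mul_eq_zero.1 h with h' | h'
          · exact absurd h' h2
          · exact h'
      exact pow_eq_zero_iff (by omega) |>.1 h3
    refine ih ht ⟨z, ?_, hp, hz, hq⟩
    intro L hL
    rcases List.mem_append.1 hL with hL' | hL'
    · exact hh L hL'
    · rw [List.mem_singleton.1 hL', ev_var z ⟨j, hj⟩]; exact hzj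

/-! ### «Every solution has its twist unknowns equal to zero» -/

/-- **KILLS**: every real point of `{hyps = 0, pins ≠ 0, gauge = 0, nonneg ≥ 0}` has `z_j = 0` for all `j ∈ J` (the cell is UNTWISTED). [folklore] -/
def Kills (n : ℕ) (hyps pins : List QMvPoly) (zs : List ℕ) (nonneg : List QMvPoly) (J : List ℕ) : Prop :=
  ∀ z : EuclideanSpace ℝ (Fin n), (∀ L ∈ hyps, ev n L z = 0) → (∀ π ∈ pins, ev n π z ≠ 0) → (∀ i ∈ zs, ∀ hi : i < n, z ⟨i, hi⟩ = 0) →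
    (∀ q ∈ nonneg, 0 ≤ ev n q z) → ∀ j ∈ J, ∀ hj : j < n, z ⟨j, hj⟩ = 0

/-- The twist pin `Σ_{j ∈ J} X_j²`. [folklore] -/
def sumSq (n : ℕ) (J : List ℕ) : QMvPoly :=
  (J.map fun j => QMvPoly.mul (QMvPoly.var n j) (QMvPoly.var n j)).flatten

/-- Value of the twist pin. [folklore] -/
theorem ev_sumSq (z : EuclideanSpace ℝ (Fin n)) (J : List ℕ) :
    ev n (sumSq n J) z = (J.map fun j => ev n (QMvPoly.var n j) z * ev n (QMvPoly.var n j) z).sum := by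
  rw [sumSq, ev_flatten, List.map_map]
  congr 1
  exact List.map_congr_left fun j _ => by simp [Function.comp, ev_mul]

/-- **THE KILL CHECK** (Boolean): all `j ∈ J` are letters, and the transcript tree refutes the system with the extra pin `Σ_{j∈J} X_j²`. [folklore] -/
def killCheck (n : ℕ) (hyps pins : List QMvPoly) (zs : List ℕ) (nonneg : List QMvPoly) (J : List ℕ) (t : ETree) : Bool :=
  (J.all fun j => decide (j < n)) && etreeCheck n hyps (pins ++ [sumSq n J]) zs nonneg t

/-- **SOUNDNESS OF THE KILL CHECK**: a checked transcript proves that every solution is untwisted. [folklore] -/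
theorem kills_of_killCheck {hyps pins : List QMvPoly} {zs : List ℕ} {nonneg : List QMvPoly} {J : List ℕ} {t : ETree}
    (h : killCheck n hyps pins zs nonneg J t = true) : Kills n hyps pins zs nonneg J := by
  simp only [killCheck, Bool.and_eq_true, List.all_eq_true, decide_eq_true_eq] at h
  obtain ⟨-, ht⟩ := h
  intro z hh hp hz hq j hjJ hj
  by_contra hne
  refine not_pointDatum_of_etreeCheck t ht ⟨z, hh, ?_, hz, hq⟩
  intro π hπ
  rcases List.mem_append.1 hπ with h' | h'
  · exact hp π h'
  · rw [List.mem_singleton.1 h', ev_sumSq]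
    have hnn : ∀ x ∈ J.map (fun j => ev n (QMvPoly.var n j) z * ev n (QMvPoly.var n j) z), (0 : ℝ) ≤ x := by
      intro x hx
      obtain ⟨j', -, rfl⟩ := List.mem_map.1 hx
      exact mul_self_nonneg _
    have hmem : ev n (QMvPoly.var n j) z * ev n (QMvPoly.var n j) z ∈
        J.map (fun j => ev n (QMvPoly.var n j) z * ev n (QMvPoly.var n j) z) := List.mem_map.2 ⟨j, hjJ, rfl⟩
    have hle := List.single_le_sum hnn _ hmem
    have hpos : 0 < ev n (QMvPoly.var n j) z * ev n (QMvPoly.var n j) z := by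
      rw [ev_var z ⟨j, hj⟩]; exact mul_self_pos.2 hne
    exact ne_of_gt (lt_of_lt_of_le hpos hle)

/-! ### Self-tests (`decide +kernel`) -/

/-- Kernel probe: the substitution machinery reduces by `decide +kernel`. [folklore] -/
theorem example_substLaw :
    substLaw 0 [([0, 0, 0], (1 : ℚ))] [([0, 0, 0], (2 : ℚ))] [([1, 2, 0], (1 : ℚ))] = [([0, 2], (1 : ℚ))] := by
  decide +kernel

/-- Kernel probe: one `elim` step followed by a trivially failing leaf evaluates (to `false`). [folklore] -/
theorem example_etree_false :
    etreeCheck 3 [[([1, 0, 0], (2 : ℚ)), ([0, 0, 0], (-1 : ℚ))]] [] [] []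
      (.elim 0 0 2 [] (.leaf { steps := [], comb := [], e := [], sos0 := [], sosG := [] })) = false := by
  decide +kernel

/-- Toy transcript: `hyps = [2·X₀ − 1, X₀·X₁², 2·X₂ − 2·X₀·X₂ − X₂]` (so `X₀ = 1/2`, then `X₁²/2 = 0` forces `X₁ = 0`, and `2X₂ − X₂ − X₂ = 0` is `0 = 0` —
`X₂` is NOT forced); `J = [1]` is killed: `elim 0 0 2 []` (law₁ then reads `2·(X₁²/2) = X₁²`) ⇒ `force 1 1 1 [] 2`, then `elim 3 1 1 []` (the adjoined law `X₁`),
leaf: the twist pin became `0`. [folklore] -/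
theorem example_killCheck :
    killCheck 3 [[([1, 0, 0], (2 : ℚ)), ([0, 0, 0], (-1 : ℚ))], [([1, 2, 0], (1 : ℚ))], [([0, 0, 1], (2 : ℚ)), ([1, 0, 1], (-2 : ℚ)), ([0, 0, 1], (-1 : ℚ))]]
      [] [] [] [1]
      (.elim 0 0 2 [] (.force 1 1 1 [] 2 (.elim 3 1 1 [] (.leaf { steps := [], comb := [], e := [1], sos0 := [], sosG := [] })))) = true := by
  decide +kernel

/-- Toy transcript, by name: every real solution of the toy system has `X₁ = 0`. [folklore] -/
theorem example_kills :
    Kills 3 [[([1, 0, 0], (2 : ℚ)), ([0, 0, 0], (-1 : ℚ))], [([1, 2, 0], (1 : ℚ))], [([0, 0, 1], (2 : ℚ)), ([1, 0, 1], (-2 : ℚ)), ([0, 0, 1], (-1 : ℚ))]]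
      [] [] [] [1] :=
  kills_of_killCheck example_killCheck

end Summit.NavierStokesRegularity.NavierStokesRegularity.Theorems.PoloidalWindowDoorLrcModEntireJetCertPsatzElim

end
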